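import Summits.AnomalousDissipation.AnomalousDissipation.Theses.ImpulseGrid

/-!
# Crux GridSigns (stmt-AnomalousDissipation-1771) — ideator 2, round 1: first lemmas of the two idea cards

Card `shape-constant-split` (wake ceilings):
* `DetunedWorkIdentity`  — EARLY RELAXATION (b) IS DETUNED WORK: the ΨG-tested momentum balance
  turns the quadratic-looking sign condition (b) into a LINEAR functional of the flow,
  `Λ⟨∫⟪w,(w·∇)(ΨG)⟫⟩ = −c·Λ⟨((Φ−1)G, u)⟩ − ν Λ⟨(u, Δ(ΨG))⟩`.
* `KickInjectionIdentity` — the spatial KICK FORMULA: momentum balance tested with `H(x₀)G(x⊥)`,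
  `∂₀H = χ_W − Φ` (χ_W an upstream window weight), gives
  `c·Λ(f,u) = c·Λ(χ_W G,u) + Λ∫χ_W w₀⟪G,w⟫ − Λ∫Φ w₀⟪G,w⟫ + Λ∫H⟪w,(w·∇)G⟫ + νΛ(u,Δ(HG)) + ‖G‖²/2`
  (free half-kick `‖G‖²/2` + correlation of the RETURNING stream + Taylor-small terms).
* `KickInjectionFloor`   — QUIET INFLOW ⇒ INJECTION FLOOR: Cauchy–Schwarz on the identity,
  `c·Λ(f,u) ≥ ‖G‖²/2 − c‖G‖₂ √(Λ∫χ_W|w|²) − ½‖G‖_∞(Λ∫χ_W|w|² + Λ∫Φ|w|²) − L_G Λ∫H|w|² − ν|Λ(u,Δ(HG))|`.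
* `EarlyRelaxationFromCeilings` — (b) from wake-energy CEILINGS only (shape of the profile).
* `NoReversalIdentity`   — (a) is the cokernel CONSTANT: `c·Λ(G,u) = c·Λ(χ_W G,u) − Λ∫Y⟪w,(w·∇)G⟫ − Λ∫(1−χ_W)w₀⟪G,w⟫ − νΛ(u,Δ(YG))`,
  `∂₀Y = 1 − χ_W`, `∫ΦY = 0` ("injection × mean destruction distance + return correlation").
Card `doppler-comb-sum-rule`:
* `ResolventSumRule` — the free half-kick as an f-sum rule: for a Hurwitz matrix `A` and any `h`,
  `∫_ℝ Re⟨h,(iω − A)⁻¹h⟩ dω = π‖h‖²`.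
All statements are `Prop` defs (no proofs); they elaborate against the route file.
-/

set_option linter.dupNamespace false

namespace Summit.AnomalousDissipation.AnomalousDissipation.Cruxes.GridSigns.Ideator2

open scoped BigOperators Topology InnerProductSpace
open Filter Set MeasureTheory
open Literature.Analysis.FunctionSpaces Literature.Analysis.FluidPDE

/-- Local shorthand: the torus, velocity space, the drift direction. -/
local notation "𝕋³" => UnitAddTorus (Fin 3)
local notation "E³" => EuclideanSpace ℝ (Fin 3)

/-- `e₀`. -/
noncomputable def e0 : E³ := EuclideanSpace.single 0 1

/-- The common hypothesis block of the grid design acting on one bounded Leray–Hopf flow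
(exactly the hypotheses of `ImpulseGrid.GridInjectionIdentity`). -/
def GridFlowHyp (ν : ℝ) (Φ Ψ : 𝕋³ → ℝ) (G : 𝕋³ → E³)
    (u₀ : 𝕋³ → E³) (u : ℝ → 𝕋³ → E³) : Prop :=
  0 < ν ∧ Torus.IsSmooth Φ ∧ Torus.IsSmooth Ψ ∧ Torus.IsSmooth G ∧
  (∀ (s : UnitAddCircle) x, Ψ (x + Pi.single (1 : Fin 3) s) = Ψ x ∧ Ψ (x + Pi.single (2 : Fin 3) s) = Ψ x) ∧
  (∀ (s : UnitAddCircle) x, G (x + Pi.single (0 : Fin 3) s) = G x) ∧ (∀ x, G x 0 = 0) ∧ Torus.IsDivFree G ∧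
  (∀ x, Torus.partialDeriv 0 Ψ x = Φ x - 1) ∧ (∫ x, Φ x * Ψ x * ‖G x‖ ^ 2 = 0) ∧
  Torus.IsGlobalLerayHopf ν (fun _ => fun x => Φ x • G x) u₀ u ∧
  (∃ C : ℝ, ∀ t : ℝ, 0 ≤ t → Torus.kineticEnergy (u t) ≤ C)

/-- **Early relaxation is detuned work** (card shape-constant-split, first lemma; provable now from
`ImpulseGrid.MeanMomentumBalance` tested with `ΨG`, using `(ΦG, ΨG) = ∫ΦΨ|G|² = 0` and the pointwise
algebra `⟪u,(u·∇)(ΨG)⟫ = c(Φ−1)⟪G,u⟫ + ⟪w,(w·∇)(ΨG)⟫`): the sign condition (b) of `GridSigns` is the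
statement that the Doppler-DETUNED part `(Φ−1)G` of the force does work `≥ η/c` (up to `O(ν)`). -/
def DetunedWorkIdentity : Prop :=
  ∀ (Λ : GeneralizedLimit) (ν c : ℝ) (Φ Ψ : 𝕋³ → ℝ) (G : 𝕋³ → E³) (u₀ : 𝕋³ → E³) (u : ℝ → 𝕋³ → E³),
    GridFlowHyp ν Φ Ψ G u₀ u →
    Λ.longTimeAvg (fun t => ∫ x, ⟪u t x - c • e0,
        Torus.convect (fun y => u t y - c • e0) (fun y => Ψ y • G y) x⟫_ℝ)
      = -c * Λ.longTimeAvg (fun t => ∫ x, (Φ x - 1) * ⟪G x, u t x⟫_ℝ)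
        - ν * Λ.longTimeAvg (fun t => ∫ x, ⟪u t x, Torus.laplacian (fun y => Ψ y • G y) x⟫_ℝ)

/-- Hypotheses on an upstream WINDOW weight `χ` (smooth, a function of `x₀` only, non-negative, unit
mass) and the KICK test function `H` (`∂₀H = χ − Φ`, `0 ≤ H ≤ 1`, `∫ΦH = 1/2`: `H` vanishes on the arc
downstream of the slab and equals `1 − F_Φ` across it). -/
def KickTestHyp (Φ χ H : 𝕋³ → ℝ) : Prop :=
  Torus.IsSmooth χ ∧ Torus.IsSmooth H ∧
  (∀ (s : UnitAddCircle) x, χ (x + Pi.single (1 : Fin 3) s) = χ x ∧ χ (x + Pi.single (2 : Fin 3) s) = χ x) ∧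
  (∀ (s : UnitAddCircle) x, H (x + Pi.single (1 : Fin 3) s) = H x ∧ H (x + Pi.single (2 : Fin 3) s) = H x) ∧
  (∀ x, 0 ≤ χ x) ∧ (∫ x, χ x = 1) ∧ (∀ x, Torus.partialDeriv 0 H x = χ x - Φ x) ∧
  (∀ x, 0 ≤ H x ∧ H x ≤ 1) ∧ (∫ x, Φ x * H x = 1 / 2)

/-- **Spatial kick formula** (exact; `MeanMomentumBalance` tested with `H(x₀)G(x⊥)` plus the pointwise
algebra `u₀⟪G,u⟫ = c⟪G,u⟫ + w₀⟪G,w⟫`, `⟪u,(u·∇)(HG)⟫ = H⟪w,(w·∇)G⟫ + (∂₀H)u₀⟪G,u⟫`): the injection is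
the FREE HALF-KICK `‖G‖²/2c` plus the `G`-correlation of the stream ARRIVING at the grid plus
cross-moment, slab-production and viscous corrections. Deterministic spatial twin of the route's
`KickLemma`. -/
def KickInjectionIdentity : Prop :=
  ∀ (Λ : GeneralizedLimit) (ν c : ℝ) (Φ Ψ χ H : 𝕋³ → ℝ) (G : 𝕋³ → E³) (u₀ : 𝕋³ → E³) (u : ℝ → 𝕋³ → E³),
    GridFlowHyp ν Φ Ψ G u₀ u → KickTestHyp Φ χ H →
    c * Λ.longTimeAvg (fun t => ∫ x, ⟪Φ x • G x, u t x⟫_ℝ)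
      = c * Λ.longTimeAvg (fun t => ∫ x, χ x * ⟪G x, u t x⟫_ℝ)
        + Λ.longTimeAvg (fun t => ∫ x, χ x * ((u t x - c • e0) 0 * ⟪G x, u t x⟫_ℝ))
        - Λ.longTimeAvg (fun t => ∫ x, Φ x * ((u t x - c • e0) 0 * ⟪G x, u t x⟫_ℝ))
        + Λ.longTimeAvg (fun t => ∫ x, H x * ⟪u t x - c • e0,
            Torus.convect (fun y => u t y - c • e0) G x⟫_ℝ)
        + ν * Λ.longTimeAvg (fun t => ∫ x, ⟪u t x, Torus.laplacian (fun y => H y • G y) x⟫_ℝ)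
        + (∫ x, ‖G x‖ ^ 2) / 2

/-- **Quiet inflow ⇒ injection floor** (Cauchy–Schwarz on `KickInjectionIdentity`; `Gmax` bounds
`|G|`, `L` bounds the symmetric gradient of `G` through `|⟪v,(v·∇)G⟫| ≤ L|v|²`). Three localized
ENERGY CEILINGS — window, slab, and the arc `supp H` between them — bound the injection from below by
the free half-kick; no sign of any correlation enters. This is the load-bearing combination
`c·(a) − (b)` of the crux. -/
def KickInjectionFloor : Prop :=
  ∀ (Λ : GeneralizedLimit) (ν c Gmax L : ℝ) (Φ Ψ χ H : 𝕋³ → ℝ) (G : 𝕋³ → E³) (u₀ : 𝕋³ → E³)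
    (u : ℝ → 𝕋³ → E³),
    GridFlowHyp ν Φ Ψ G u₀ u → KickTestHyp Φ χ H → 0 < c → (∀ x, 0 ≤ Φ x) →
    (∀ x, ‖G x‖ ≤ Gmax) → (∀ x (v : E³), |⟪v, Torus.convect (fun _ => v) G x⟫_ℝ| ≤ L * ‖v‖ ^ 2) →
    c * Λ.longTimeAvg (fun t => ∫ x, ⟪Φ x • G x, u t x⟫_ℝ)
      ≥ (∫ x, ‖G x‖ ^ 2) / 2
        - c * Real.sqrt (∫ x, ‖G x‖ ^ 2) *
            Real.sqrt (Λ.longTimeAvg (fun t => ∫ x, χ x * ‖u t x - c • e0‖ ^ 2))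
        - (Gmax / 2) * (Λ.longTimeAvg (fun t => ∫ x, χ x * ‖u t x - c • e0‖ ^ 2)
            + Λ.longTimeAvg (fun t => ∫ x, Φ x * ‖u t x - c • e0‖ ^ 2))
        - L * Λ.longTimeAvg (fun t => ∫ x, H x * ‖u t x - c • e0‖ ^ 2)
        - ν * |Λ.longTimeAvg (fun t => ∫ x, ⟪u t x, Torus.laplacian (fun y => H y • G y) x⟫_ℝ)|

/-- **(b) from wake-energy ceilings alone** (`DetunedWorkIdentity` + `KickInjectionFloor` + the bulk
Cauchy–Schwarz `|Λ(G,u)| ≤ ‖G‖₂ √(Λ‖w‖²)`): EARLY RELAXATION is a property of the SHAPE of the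
`G`-momentum profile and is forced once the wake is quiet upstream, thin at the slab and has small
BULK energy compared with the kick — an upper bound on positive quadratic functionals, never a
sign. -/
def EarlyRelaxationFromCeilings : Prop :=
  ∀ (Λ : GeneralizedLimit) (ν c Gmax L : ℝ) (Φ Ψ χ H : 𝕋³ → ℝ) (G : 𝕋³ → E³) (u₀ : 𝕋³ → E³)
    (u : ℝ → 𝕋³ → E³),
    GridFlowHyp ν Φ Ψ G u₀ u → KickTestHyp Φ χ H → 0 < c → (∀ x, 0 ≤ Φ x) →
    (∀ x, ‖G x‖ ≤ Gmax) → (∀ x (v : E³), |⟪v, Torus.convect (fun _ => v) G x⟫_ℝ| ≤ L * ‖v‖ ^ 2) →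
    Λ.longTimeAvg (fun t => ∫ x, ⟪u t x - c • e0,
        Torus.convect (fun y => u t y - c • e0) (fun y => Ψ y • G y) x⟫_ℝ)
      ≤ -((∫ x, ‖G x‖ ^ 2) / 2
          - c * Real.sqrt (∫ x, ‖G x‖ ^ 2) *
              (Real.sqrt (Λ.longTimeAvg (fun t => ∫ x, χ x * ‖u t x - c • e0‖ ^ 2))
               + Real.sqrt (Λ.longTimeAvg (fun t => ∫ x, ‖u t x - c • e0‖ ^ 2)))
          - (Gmax / 2) * (Λ.longTimeAvg (fun t => ∫ x, χ x * ‖u t x - c • e0‖ ^ 2)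
              + Λ.longTimeAvg (fun t => ∫ x, Φ x * ‖u t x - c • e0‖ ^ 2))
          - L * Λ.longTimeAvg (fun t => ∫ x, H x * ‖u t x - c • e0‖ ^ 2))
        + ν * (|Λ.longTimeAvg (fun t => ∫ x, ⟪u t x, Torus.laplacian (fun y => H y • G y) x⟫_ℝ)|
              + |Λ.longTimeAvg (fun t => ∫ x, ⟪u t x, Torus.laplacian (fun y => Ψ y • G y) x⟫_ℝ)|)

/-- **(a) is the cokernel constant** (exact; `MeanMomentumBalance` tested with `Y(x₀)G(x⊥)`,
`∂₀Y = 1 − χ`, `∫ΦY = 0`: `Y` = distance travelled since the slab, reset at the window): the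
resonant work `c·Λ(G,u)` = (momentum injection rate `‖G‖²`) × (mean destruction distance
`−‖G‖⁻²Λ∫Y⟪w,(w·∇)G⟫`) + `c ×` (correlation of the RETURNING stream) + Taylor-small cross moments.
NO REVERSAL therefore reduces to one scalar: the returning stream is not anti-aligned with `G` by
more than the (small, positive) destruction-distance budget. -/
def NoReversalIdentity : Prop :=
  ∀ (Λ : GeneralizedLimit) (ν c : ℝ) (Φ Ψ χ Y : 𝕋³ → ℝ) (G : 𝕋³ → E³) (u₀ : 𝕋³ → E³) (u : ℝ → 𝕋³ → E³),
    GridFlowHyp ν Φ Ψ G u₀ u → Torus.IsSmooth χ → Torus.IsSmooth Y →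
    (∀ (s : UnitAddCircle) x, χ (x + Pi.single (1 : Fin 3) s) = χ x ∧ χ (x + Pi.single (2 : Fin 3) s) = χ x) →
    (∀ (s : UnitAddCircle) x, Y (x + Pi.single (1 : Fin 3) s) = Y x ∧ Y (x + Pi.single (2 : Fin 3) s) = Y x) →
    (∫ x, χ x = 1) → (∀ x, Torus.partialDeriv 0 Y x = 1 - χ x) → (∫ x, Φ x * Y x = 0) →
    c * Λ.longTimeAvg (fun t => ∫ x, ⟪G x, u t x⟫_ℝ)
      = c * Λ.longTimeAvg (fun t => ∫ x, χ x * ⟪G x, u t x⟫_ℝ)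
        - Λ.longTimeAvg (fun t => ∫ x, Y x * ⟪u t x - c • e0,
            Torus.convect (fun y => u t y - c • e0) G x⟫_ℝ)
        - Λ.longTimeAvg (fun t => ∫ x, (1 - χ x) * ((u t x - c • e0) 0 * ⟪G x, u t x⟫_ℝ))
        - ν * Λ.longTimeAvg (fun t => ∫ x, ⟪u t x, Torus.laplacian (fun y => Y y • G y) x⟫_ℝ)

/-- **The free half-kick is an f-sum rule** (card doppler-comb-sum-rule, first lemma; finite-dimensional
linear-algebra core, provable in Mathlib: residues of the resolvent of a Hurwitz matrix): for a
stable linear(ised) dynamics `ẋ = Ax + h e^{iωt}`, the cycle-averaged power absorbed from the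
drive, `P(ω) = Re⟨h,(iω − A)⁻¹h⟩`, integrates over all frequencies to `π‖h‖²` — the ballistic
response `R(0⁺) = ‖h‖²`, i.e. the `½‖g‖²` of the kick formula — WHATEVER `A` is. A thin grid crossed
at speed `c` is a frequency comb `ω ∈ 2πcℕ` sampling `P`; a fine comb (Taylor's window) integrates
the sum rule, so the detuned harmonics absorb `> 0` irrespective of the sign structure of `P`. -/
def ResolventSumRule : Prop :=
  ∀ (n : ℕ) (A : Matrix (Fin n) (Fin n) ℂ) (h : Fin n → ℂ),
    (∀ z ∈ spectrum ℂ (Matrix.toLin' A), z.re < 0) →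
    ∫ ω : ℝ, (dotProduct (star h)
        (Matrix.mulVec (((ω : ℂ) * Complex.I) • (1 : Matrix (Fin n) (Fin n) ℂ) - A)⁻¹ h)).re
      = Real.pi * ∑ i, ‖h i‖ ^ 2


/-- **Doppler comb = return-lag echoes** (card doppler-comb-sum-rule, second lemma; pure real analysis — Poisson summation for the
cosine transform of a causal response function `R`): the power absorbed by a unit frequency comb `ω ∈ 2πc·ℕ₊` from a medium with
response function `R` equals a quarter of the ballistic value `R(0)` per unit `c`, plus the ECHOES of `R` at the return lags `n/c`,
minus half the integral response time. With `R(0⁺) = ‖h‖²` (free kick) this is the frequency-side form of the kick formula, and (b) of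
`GridSigns` for a weak thin grid on homogeneous stirring reads `c·∫R/R(0) < 1/2 + Σ_{n≥1} R(n/c)/R(0)`. Hypotheses kept abstract
(continuity, integrability, summability); the Schwartz-class case is Mathlib's `Real.tsum_eq_tsum_fourierIntegral`. -/
def CombPoissonIdentity : Prop :=
  ∀ (R : ℝ → ℝ) (c : ℝ), 0 < c → ContinuousOn R (Set.Ici 0) → IntegrableOn R (Set.Ioi 0) →
    IntegrableOn (fun t => t ^ 2 * |R t|) (Set.Ioi 0) → ContDiffOn ℝ 2 R (Set.Ici 0) →
    IntegrableOn (fun t => |deriv (deriv R) t|) (Set.Ioi 0) →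
    Summable (fun n : ℕ => R ((n + 1 : ℝ) / c)) →
    HasSum (fun k : ℕ => ∫ t in Set.Ioi 0, R t * Real.cos (2 * Real.pi * c * (k + 1 : ℝ) * t))
      ((1 / (4 * c)) * (R 0 + 2 * ∑' n : ℕ, R ((n + 1 : ℝ) / c)) - (1 / 2) * ∫ t in Set.Ioi 0, R t)

/-- **Weak-grid response hypothesis** (card doppler-comb-sum-rule, K1 ∧ K2 typed as ONE `Prop` over the crux's own objects):
for the design family `Φ_κ = (1−κ) + κ·comb` (unit mass for every `κ`) with a fixed comb profile, pattern `G` and drift `c`,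
there are bounded-energy drift Leray–Hopf families `u κ j` (viscosities `ν j → 0`, common to all `κ`) whose DETUNED WORK
`c·Λ⟨((Φ_κ − 1)G, u)⟩` is, up to `C κ³` uniformly in `j`, the comb-sampled cosine transform of a causal response function `R j`
with the ballistic normalisation `R j 0 = ‖G‖²` (free kick / f-sum rule) and a `ν`-uniform integrable tail (`K2`), and whose
RESONANT WORK `Λ⟨(G,u)⟩` moves by at most `C κ²` from its `κ = 0` value `a₀ j`. (Second-order response of long-time statistics in
the grid strength; the physics content of the card.) -/
def WeakGridResponseHypothesis : Prop :=
  ∃ (comb : 𝕋³ → ℝ) (G : 𝕋³ → E³) (c κ₀ C τ : ℝ) (ν : ℕ → ℝ) (R a₀ : ℕ → ℝ → ℝ)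
    (u : ℝ → ℕ → ℝ → 𝕋³ → E³) (Λ : GeneralizedLimit),
    0 < c ∧ 0 < κ₀ ∧ 0 ≤ C ∧ 0 < τ ∧ (∀ j, 0 < ν j) ∧ Tendsto ν atTop (nhds 0) ∧
    Torus.IsSmooth comb ∧ Torus.IsSmooth G ∧ (∫ x, comb x = 1) ∧
    (∀ (s : UnitAddCircle) x, comb (x + Pi.single (1 : Fin 3) s) = comb x ∧ comb (x + Pi.single (2 : Fin 3) s) = comb x) ∧
    (∀ (s : UnitAddCircle) x, G (x + Pi.single (0 : Fin 3) s) = G x) ∧ (∀ x, G x 0 = 0) ∧ Torus.IsDivFree G ∧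
    (∀ j, R j 0 = ∫ x, ‖G x‖ ^ 2) ∧
    (∀ j, ∫ t in Set.Ioi 0, |R j t| * (1 + t) ≤ τ * ∫ x, ‖G x‖ ^ 2) ∧
    ∀ κ, 0 < κ → κ ≤ κ₀ → ∀ j,
      (∃ u₀ : 𝕋³ → E³, (∫ x, u₀ x = c • e0) ∧
        Torus.IsGlobalLerayHopf (ν j) (fun _ => fun x => ((1 - κ) + κ * comb x) • G x) u₀ (u κ j)) ∧
      |c * Λ.longTimeAvg (fun t => ∫ x, (κ * (comb x - 1)) * ⟪G x, u κ j t x⟫_ℝ)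
          - 2 * κ ^ 2 * c * ∑' k : ℕ,
              ‖UnitAddTorus.mFourierCoeff (fun x => (comb x : ℂ)) (Pi.single (0 : Fin 3) ((k : ℤ) + 1))‖ ^ 2 *
              ∫ t in Set.Ioi 0, R j t * Real.cos (2 * Real.pi * c * (k + 1 : ℝ) * t)| ≤ C * κ ^ 3 ∧
      |Λ.longTimeAvg (fun t => ∫ x, ⟪G x, u κ j t x⟫_ℝ) - a₀ j 0| ≤ C * κ ^ 2

/-- Sanity: the crux decl is in scope by name (the cards' lines must conclude it literally). -/
example : Prop := Summit.AnomalousDissipation.AnomalousDissipation.Theses.ImpulseGrid.GridSigns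

end Summit.AnomalousDissipation.AnomalousDissipation.Cruxes.GridSigns.Ideator2
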